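import Summits.Ventures.PercRepro.Night2LocalDQFour

/-!
# PercRepro — the regime `|E ∖ G| = q` with `q − 1` coloops, and `q = 5` for SIMPLE matroids (night-2, gen 11)

The two structure lemmas of `Night2LocalDQFourCore.lean` hold at every `q` with `k = q − 1` coloops (the
numerals `4`, `3` were `q`, `q − 1`): `ex2_eq_empty_of_card_coloops_eq` (no layer-2 weight at a shadow set with
`q` coloops) and `not_two_ex2_of_card_two_penult` (at most one `|G ∖ cl B| = 2` member carries layer-2 weight at a
shadow set with `q − 1` coloops and a layer-0 covering preimage).  The resulting column bound
`load₂ ≤ 2ℓ*(1 + 2/2) = 4ℓ*` against `cap₂ ≥ ((q+1)·2 − (q−1))/(q+1)²` (and `6ℓ* ≤ 2/(q+1)` without layer-0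
preimage) holds exactly for `q ≤ 5`; at `q = 5` both cases are tight.  Hence:

* **`localShadowHall_dq_five_four`** (`q = 5`, `k = 4`) and **`localShadowHall_dq_five_of_simple`** (every `k`):
  the local form at every rank-`6` flat with `|E ∖ G| = 5` of a loopless simple matroid — the regime `d = q` of
  the `(7, 5)` shadow row is closed for simple matroids (Theorem E's open cell `k = 4` at `q = 5`).
-/

open scoped Matroid

namespace PercRepro.Shadow

open Finset PerFlat ThmH

variable {α : Type*} [DecidableEq α] {M : Matroid α} [M.Finite]

section Penult

variable {q : ℕ} {G S : Finset α}

/-- **With `q` coloops at a shadow set there is no layer-2 weight** (every `q`): the non-coloops have rank `1`, so a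
series pair would be a parallel pair. -/
theorem ex2_eq_empty_of_card_coloops_eq (hs : ∀ e ∈ gr M, ∀ f ∈ gr M, e ≠ f → rkN M {e, f} = 2)
    (hG : G ∈ flatsQ M (q + 1)) (hS : S ∈ shadowAt M (q + 2) q (Uq M (q + 2) q) G)
    (ha : (coloops M S).card = q) : ex2 M q G S = ∅ := by
  rw [Finset.eq_empty_iff_forall_notMem]
  intro B hB
  have hSG : S ⊆ G := subset_of_mem_shadowAt hS
  have hSE : S ⊆ gr M := hSG.trans (mem_flatsQ.1 hG).1
  have hSr : rkN M S = q + 1 := rkN_eq_of_mem_shadowAt hS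
  have hP := sdiff_mem_seriesPairs hG hS hB
  have hPT := subset_nonColoops_of_mem_seriesPairs hSE hSr hP
  have hcardP : (S \ B).card = 2 := (mem_ex2_unpack hB).2.2.2.2
  have h1 : rkN M (nonColoops M S) = 1 := by
    have := rkN_nonColoops_add hSE
    omega
  have h2 : (nonColoops M S).card ≤ 1 := by
    apply card_le_one_of_eRk_le_one hs (X := nonColoops M S)
      (by unfold nonColoops; exact Finset.sdiff_subset.trans hSE)
    rw [eRk_eq_rkN, h1]
    exact le_rfl
  have := Finset.card_le_card hPT
  omega

/-- **Two members of `ex2` with `|G ∖ cl B| = 2` are impossible at a shadow set with a layer-0 covering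
preimage** (every `q ≥ 1`, `k = q − 1 = #coloops(S)`, loopless simple `M`): two such members force `G = S`, and
then the layer-0 preimage `G ∖ y` has a complement `(E ∖ G) ∪ {y}` of rank `≤ q + 1 < q + 2`. -/
theorem not_two_ex2_of_card_two_penult (hq : 1 ≤ q) (hs : ∀ e ∈ gr M, ∀ f ∈ gr M, e ≠ f → rkN M {e, f} = 2)
    (hl : ∀ e ∈ gr M, M.Indep {e}) (hG : G ∈ flatsQ M (q + 1)) (hd : (gr M \ G).card = q)
    (hk : kColoops M G = q - 1) (hS : S ∈ shadowAt M (q + 2) q (Uq M (q + 2) q) G)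
    (ha : (coloops M S).card = q - 1) (hk1 : 1 ≤ k1 M q G S) {B₁ B₂ : Finset α}
    (h1 : B₁ ∈ ex2 M q G S) (h2 : B₂ ∈ ex2 M q G S) (hne : B₁ ≠ B₂)
    (hm1 : (G \ clF M B₁).card = 2) (hm2 : (G \ clF M B₂).card = 2) : False := by
  classical
  have hSG : S ⊆ G := subset_of_mem_shadowAt hS
  have hGE : G ⊆ gr M := (mem_flatsQ.1 hG).1
  have hSE : S ⊆ gr M := hSG.trans hGE
  have hSr : rkN M S = q + 1 := rkN_eq_of_mem_shadowAt hS
  obtain ⟨hB1m, -, hB1S, -, hc1⟩ := mem_ex2_unpack h1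
  obtain ⟨hB2m, -, hB2S, -, hc2⟩ := mem_ex2_unpack h2
  have hB1U : B₁ ∈ Uq M (q + 2) q := (mem_membersIn.1 hB1m).1
  have hB2U : B₂ ∈ Uq M (q + 2) q := (mem_membersIn.1 hB2m).1
  -- the series pairs P₁, P₂ ⊆ T := nonColoops S
  set P₁ := S \ B₁ with hP₁
  set P₂ := S \ B₂ with hP₂
  have hP1s := sdiff_mem_seriesPairs hG hS h1
  have hP2s := sdiff_mem_seriesPairs hG hS h2
  have hP1T : P₁ ⊆ nonColoops M S := subset_nonColoops_of_mem_seriesPairs hSE hSr hP1s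
  have hP2T : P₂ ⊆ nonColoops M S := subset_nonColoops_of_mem_seriesPairs hSE hSr hP2s
  have hB1eq : B₁ = S \ P₁ := (Finset.sdiff_sdiff_eq_self hB1S).symm
  have hB2eq : B₂ = S \ P₂ := (Finset.sdiff_sdiff_eq_self hB2S).symm
  have hPne : P₁ ≠ P₂ := fun h => hne (by rw [hB1eq, hB2eq, h])
  -- |T| ≤ 3 : ρ(T ∖ P₁) = 1
  obtain ⟨x, y, hxy, hPxy, hser⟩ := exists_pair_of_mem_seriesPairs hP1s
  rw [← hP₁] at hPxy
  have hT1 : rkN M (nonColoops M S \ P₁) = 1 := by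
    have hunion : coloops M S ∪ (nonColoops M S \ P₁) = S \ P₁ := by
      ext e
      simp only [Finset.mem_union, Finset.mem_sdiff, nonColoops]
      constructor
      · rintro (he | ⟨⟨heS, -⟩, heP⟩)
        · exact ⟨coloops_subset_self S he, fun heP => (Finset.mem_sdiff.1 (hP1T heP)).2 he⟩
        · exact ⟨heS, heP⟩
      · rintro ⟨heS, heP⟩
        by_cases hc : e ∈ coloops M S
        · exact Or.inl hc
        · exact Or.inr ⟨⟨heS, hc⟩, heP⟩
    have h := eRk_union_coloops hSE (coloops M S) (fun y hy => mem_coloops.1 hy)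
      (X := nonColoops M S \ P₁) (Finset.sdiff_subset.trans Finset.sdiff_subset)
      (Finset.disjoint_of_subset_right Finset.sdiff_subset Finset.disjoint_sdiff)
    rw [hunion, ha, eRk_eq_rkN, eRk_eq_rkN] at h
    have hr4 : rkN M (S \ P₁) = q := by rw [hPxy]; exact hser.2.2.2.2.2
    rw [hr4] at h
    have h' : q = q - 1 + rkN M (nonColoops M S \ P₁) := by exact_mod_cast h
    omega
  have hT3 : (nonColoops M S).card ≤ 3 := by
    have hle : (nonColoops M S \ P₁).card ≤ 1 := by
      apply card_le_one_of_eRk_le_one hs (X := nonColoops M S \ P₁)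
        (Finset.sdiff_subset.trans (Finset.sdiff_subset.trans hSE))
      rw [eRk_eq_rkN, hT1]
      exact le_rfl
    have := Finset.card_sdiff_add_card_eq_card hP1T
    omega
  -- P₁ ∩ P₂ = {w}, P₁ ∪ P₂ = T
  have hcU : (P₁ ∪ P₂).card ≤ 3 := (Finset.card_le_card (Finset.union_subset hP1T hP2T)).trans hT3
  have hUI := Finset.card_union_add_card_inter P₁ P₂
  have hI1 : (P₁ ∩ P₂).card ≤ 1 := by
    by_contra hlt
    push Not at hlt
    have hsub : P₁ ∩ P₂ ⊆ P₁ := Finset.inter_subset_left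
    have heq : P₁ ∩ P₂ = P₁ := Finset.eq_of_subset_of_card_le hsub (by omega)
    have h12 : P₁ ⊆ P₂ := by rw [← heq]; exact Finset.inter_subset_right
    exact hPne (Finset.eq_of_subset_of_card_le h12 (by omega))
  have hIcard : (P₁ ∩ P₂).card = 1 := by omega
  obtain ⟨w, hw⟩ := Finset.card_eq_one.1 hIcard
  have hUT : P₁ ∪ P₂ = nonColoops M S :=
    Finset.eq_of_subset_of_card_le (Finset.union_subset hP1T hP2T) (by omega)
  -- B₁ ∪ B₂ = S ∖ {w} has rank 5; B₁ ∩ B₂ = coloops S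
  have hwP : w ∈ P₁ := Finset.inter_subset_left (hw ▸ Finset.mem_singleton_self w)
  have hrw : rkN M (S.erase w) = q + 1 := by
    rw [hPxy, Finset.mem_insert, Finset.mem_singleton] at hwP
    rcases hwP with rfl | rfl
    · exact hser.2.2.2.1
    · exact hser.2.2.2.2.1
  have hBU : B₁ ∪ B₂ = S.erase w := by
    rw [hB1eq, hB2eq, ← Finset.sdiff_inter_distrib_right, hw, Finset.sdiff_singleton_eq_erase]
  have hBI : B₁ ∩ B₂ = coloops M S := by
    rw [hB1eq, hB2eq, ← Finset.sdiff_union_distrib, hUT]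
    unfold nonColoops
    exact Finset.sdiff_sdiff_eq_self (coloops_subset_self S)
  -- G ⊆ S
  have hGS : G ⊆ S := by
    intro g hg
    by_contra hgS
    have hg1 : g ∈ clF M B₁ := by
      by_contra h
      have : g ∈ S \ B₁ := by rw [sdiff_eq_of_mem_ex2 h1 hm1]; exact Finset.mem_sdiff.2 ⟨hg, h⟩
      exact hgS (Finset.mem_sdiff.1 this).1
    have hg2 : g ∈ clF M B₂ := by
      by_contra h
      have : g ∈ S \ B₂ := by rw [sdiff_eq_of_mem_ex2 h2 hm2]; exact Finset.mem_sdiff.2 ⟨hg, h⟩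
      exact hgS (Finset.mem_sdiff.1 this).1
    -- K ∪ {g} has rank 4
    have hK : coloops M S = G.filter (fun y => y ∉ clF M (G.erase y)) :=
      coloops_eq_filter_of_card hS (by rw [ha, hk])
    have hKg : rkN M (coloops M S ∪ {g}) = q := by
      have h := eRk_union_coloops hGE (coloops M S)
        (fun y hy => by rw [hK, Finset.mem_filter] at hy; exact hy) (X := {g})
        (Finset.singleton_subset_iff.2 hg)
        (Finset.disjoint_singleton_right.2 (fun h => hgS (coloops_subset_self S h)))
      have hg1' : M.eRk (({g} : Finset α) : Set α) = 1 := by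
        rw [Finset.coe_singleton, (hl g (hGE hg)).eRk_eq_encard, Set.encard_singleton]
      rw [ha, hg1', eRk_eq_rkN] at h
      have h' : rkN M (coloops M S ∪ {g}) = q - 1 + 1 := by exact_mod_cast h
      omega
    -- B_i ⊆ cl (K ∪ {g})
    have hKsub : ∀ B ∈ ({B₁, B₂} : Finset (Finset α)), coloops M S ⊆ B := by
      intro B hB
      rw [Finset.mem_insert, Finset.mem_singleton] at hB
      rcases hB with rfl | rfl
      · rw [← hBI]; exact Finset.inter_subset_left
      · rw [← hBI]; exact Finset.inter_subset_right
    have hcl : ∀ B, B ∈ Uq M (q + 2) q → coloops M S ⊆ B → g ∈ clF M B →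
        (B : Set α) ⊆ M.closure ((coloops M S ∪ {g} : Finset α) : Set α) := by
      intro B hBU hKB hgB
      have hBE : B ⊆ gr M := (mem_Uq.1 hBU).1
      have hX : B ∪ (coloops M S ∪ {g}) ⊆ gr M :=
        Finset.union_subset hBE (Finset.union_subset (hKB.trans hBE) (Finset.singleton_subset_iff.2 (hGE hg)))
      have hXcl : B ∪ (coloops M S ∪ {g}) ⊆ clF M B := by
        apply Finset.union_subset (subset_clF_of_subset_gr hBE)
        apply Finset.union_subset (hKB.trans (subset_clF_of_subset_gr hBE))
        exact Finset.singleton_subset_iff.2 hgB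
      have hr : rkN M (coloops M S ∪ {g}) = rkN M (B ∪ (coloops M S ∪ {g})) := by
        apply le_antisymm (rkN_mono Finset.subset_union_right)
        rw [hKg]
        exact rkN_le_of_subset_clF hBU hXcl
      exact (Finset.coe_subset.2 Finset.subset_union_left).trans
        (subset_closure_of_rkN_eq hX Finset.subset_union_right hr)
    have hsub : ((B₁ ∪ B₂ : Finset α) : Set α) ⊆ M.closure ((coloops M S ∪ {g} : Finset α) : Set α) := by
      rw [Finset.coe_union]
      exact Set.union_subset (hcl B₁ hB1U (hKsub B₁ (by simp)) hg1) (hcl B₂ hB2U (hKsub B₂ (by simp)) hg2)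
    have hle : M.eRk ((B₁ ∪ B₂ : Finset α) : Set α) ≤ M.eRk ((coloops M S ∪ {g} : Finset α) : Set α) := by
      calc M.eRk ((B₁ ∪ B₂ : Finset α) : Set α)
          ≤ M.eRk (M.closure ((coloops M S ∪ {g} : Finset α) : Set α)) := M.eRk_mono hsub
        _ = _ := M.eRk_closure_eq _
    rw [hBU, eRk_eq_rkN, eRk_eq_rkN, hrw, hKg] at hle
    have : (q + 1 : ℕ) ≤ q := by exact_mod_cast hle
    omega
  have hGeq : G = S := Finset.Subset.antisymm hGS hSG
  -- the layer-0 covering preimage B₀ = G ∖ y has a complement of rank ≤ 5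
  unfold k1 at hk1
  obtain ⟨B₀, hB₀⟩ := Finset.card_pos.1 hk1
  rw [Finset.mem_filter, mem_coverPreimages] at hB₀
  obtain ⟨⟨hB₀m, hcov⟩, -⟩ := hB₀
  obtain ⟨y, hy, hyS⟩ := mem_coverSets.1 hcov
  have hB₀U : B₀ ∈ Uq M (q + 2) q := (mem_membersIn.1 hB₀m).1
  have hyB : y ∉ B₀ := notMem_of_notMem_clF hB₀U (Finset.mem_sdiff.1 hy).2
  have hB₀eq : B₀ = G.erase y := by rw [hGeq, ← hyS, Finset.erase_insert hyB]
  have hcompl : gr M \ B₀ ⊆ insert y (gr M \ G) := by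
    intro e he
    rw [Finset.mem_sdiff, hB₀eq, Finset.mem_erase] at he
    rw [Finset.mem_insert, Finset.mem_sdiff]
    by_cases hey : e = y
    · exact Or.inl hey
    · exact Or.inr ⟨he.1, fun heG => he.2 ⟨hey, heG⟩⟩
  have hcard : (gr M \ B₀).card ≤ q + 1 := by
    calc (gr M \ B₀).card ≤ (insert y (gr M \ G)).card := Finset.card_le_card hcompl
      _ ≤ (gr M \ G).card + 1 := Finset.card_insert_le _ _
      _ = q + 1 := by rw [hd]
  have hr6 : M.eRk ((gr M \ B₀ : Finset α) : Set α) = ((q + 2 : ℕ) : ℕ∞) := (mem_Uq.1 hB₀U).2.2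
  have hle : M.eRk ((gr M \ B₀ : Finset α) : Set α) ≤ ((gr M \ B₀).card : ℕ∞) := by
    rw [← Set.encard_coe_eq_coe_finsetCard]
    exact M.eRk_le_encard _
  rw [hr6] at hle
  have : (q + 2 : ℕ) ≤ (gr M \ B₀).card := by exact_mod_cast hle
  omega

end Penult

section Five

variable {G S : Finset α}

open scoped Classical in
/-- **The column bound at `q = 5`, `k = 4`, four coloops of `S`** (loopless simple `M`):
`load₂(S) ≤ cap₂(S)`; both sub-cases are tight. -/
theorem load2_le_cap2_of_four_five (hs : ∀ e ∈ gr M, ∀ f ∈ gr M, e ≠ f → rkN M {e, f} = 2)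
    (hl : ∀ e ∈ gr M, M.Indep {e}) (hG : G ∈ flatsQ M (5 + 1)) (hd : (gr M \ G).card = 5)
    (hk : kColoops M G = 4) (hS : S ∈ shadowAt M (5 + 2) 5 (Uq M (5 + 2) 5) G)
    (ha : (coloops M S).card = 4) : load2 M 5 G S ≤ cap2 M 5 G S := by
  have hSG : S ⊆ G := subset_of_mem_shadowAt hS
  have hex : 2 * (ex2 M 5 G S).card ≤ (5 + 2 - 4) * (5 + 1 - 4) := by
    have := two_mul_card_ex2_le hG hS
    rwa [ha] at this
  have hex3 : (ex2 M 5 G S).card ≤ 3 := by omega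
  have hcap := cap2_ge_dq hG hd hS
  rw [ha] at hcap
  have hk1 : k1 M 5 G S ≤ 4 := hk ▸ k1_le_kColoops hSG
  have hk1' : (k1 M 5 G S : ℚ) ≤ 4 := by exact_mod_cast hk1
  have hstar : 2 * ((kColoops M G : ℚ) / ((((5 : ℕ) : ℚ) + 1) ^ 2 * ((((5 : ℕ) : ℚ) + 1) - (kColoops M G : ℚ))))
      = 1 / 9 := by
    rw [hk]; norm_num
  by_cases hk10 : k1 M 5 G S = 0
  · -- no layer-0 preimage: cap₂ ≥ 10/25 and load₂ ≤ 3·(3/25)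
    have hload := load2_le_dq hG hd (by omega) S
    rw [hstar] at hload
    have hex3' : ((ex2 M 5 G S).card : ℚ) ≤ 3 := by exact_mod_cast hex3
    rw [hk10] at hcap
    norm_num at hcap
    nlinarith [hload, hcap, hex3']
  · -- a layer-0 preimage: at most one member with |G ∖ cl B| = 2
    have hk11 : 1 ≤ k1 M 5 G S := Nat.one_le_iff_ne_zero.2 hk10
    have hw : ∀ B ∈ ex2 M 5 G S,
        w2 M 5 G B S ≤ if (G \ clF M B).card = 2 then (1 : ℚ) / 9 else 1 / 18 := by
      intro B hB
      have h := w2_le_dq_div hG hd (by omega) hB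
      rw [hstar] at h
      have hm : 2 ≤ (G \ clF M B).card := by
        obtain ⟨-, -, -, hsub, hcard⟩ := mem_ex2_unpack hB
        exact hcard ▸ Finset.card_le_card hsub
      split_ifs with h2
      · rw [h2] at h
        norm_num at h
        exact h
      · have h3 : (3 : ℚ) ≤ ((G \ clF M B).card : ℚ) := by
          have : 3 ≤ (G \ clF M B).card := by omega
          exact_mod_cast this
        calc w2 M 5 G B S ≤ 1 / 9 / (((G \ clF M B).card : ℚ) - 1) := h
          _ ≤ 1 / 9 / 2 := by
              apply div_le_div_of_nonneg_left (by norm_num) (by norm_num)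
              linarith
          _ = 1 / 18 := by norm_num
    have hload : load2 M 5 G S ≤
        ∑ B ∈ ex2 M 5 G S, (if (G \ clF M B).card = 2 then (1 : ℚ) / 9 else 1 / 18) := by
      unfold load2
      rw [← Finset.sum_filter_ne_zero]
      exact Finset.sum_le_sum (fun B hB => hw B hB)
    rw [Finset.sum_ite, Finset.sum_const, Finset.sum_const, nsmul_eq_mul, nsmul_eq_mul] at hload
    have hA : ((ex2 M 5 G S).filter (fun B => (G \ clF M B).card = 2)).card ≤ 1 := by
      rw [Finset.card_le_one]
      intro B₁ hB₁ B₂ hB₂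
      rw [Finset.mem_filter] at hB₁ hB₂
      by_contra hne
      exact not_two_ex2_of_card_two_penult (by norm_num) hs hl hG hd (by omega) hS (by omega) hk11 hB₁.1 hB₂.1 hne
        hB₁.2 hB₂.2
    have hAC : ((ex2 M 5 G S).filter (fun B => (G \ clF M B).card = 2)).card +
        ((ex2 M 5 G S).filter (fun B => ¬ (G \ clF M B).card = 2)).card = (ex2 M 5 G S).card :=
      Finset.card_filter_add_card_filter_not _
    have hA' : (((ex2 M 5 G S).filter (fun B => (G \ clF M B).card = 2)).card : ℚ) ≤ 1 := by
      exact_mod_cast hA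
    have hC' : (((ex2 M 5 G S).filter (fun B => ¬ (G \ clF M B).card = 2)).card : ℚ) ≤
        3 - (((ex2 M 5 G S).filter (fun B => (G \ clF M B).card = 2)).card : ℚ) := by
      have : ((ex2 M 5 G S).filter (fun B => ¬ (G \ clF M B).card = 2)).card ≤
          3 - ((ex2 M 5 G S).filter (fun B => (G \ clF M B).card = 2)).card := by omega
      have h1 : (((ex2 M 5 G S).filter (fun B => (G \ clF M B).card = 2)).card : ℚ) ≤ 3 := by
        exact_mod_cast (show ((ex2 M 5 G S).filter (fun B => (G \ clF M B).card = 2)).card ≤ 3 by omega)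
      have h2 := Nat.cast_le (α := ℚ) |>.2 this
      rw [Nat.cast_sub (by omega)] at h2
      push_cast at h2
      exact h2
    have hcap' : (2 : ℚ) / 9 ≤ cap2 M 5 G S := by
      refine le_trans ?_ hcap
      norm_num
      linarith
    calc load2 M 5 G S ≤ _ := hload
      _ ≤ 2 / 9 := by nlinarith [hA', hC']
      _ ≤ cap2 M 5 G S := hcap'

/-- **Theorem E's open cell at `q = 5`**: the local form at a rank-`6` flat `G` with `|E ∖ G| = 5` whose
restriction `M|G` has exactly `4` coloops, for a loopless simple matroid. -/
theorem localShadowHall_dq_five_four (hs : ∀ e ∈ gr M, ∀ f ∈ gr M, e ≠ f → rkN M {e, f} = 2)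
    (hl : ∀ e ∈ gr M, M.Indep {e}) (hG : G ∈ flatsQ M (5 + 1)) (hd : (gr M \ G).card = 5)
    (hk : kColoops M G = 4) : LocalShadowHall M 5 G := by
  classical
  apply localShadowHall_of_distance_two hG hd.le
  intro S hS
  have hSG : S ⊆ G := subset_of_mem_shadowAt hS
  have hSE : S ⊆ gr M := hSG.trans (mem_flatsQ.1 hG).1
  have ha3 : 4 ≤ (coloops M S).card := hk ▸ kColoops_le_card_coloops hS
  have ha5 : (coloops M S).card ≤ 5 + 1 :=
    card_coloops_le hSE (eRk_eq_of_mem_Yq_diag (mem_shadow.1 (mem_shadowAt.1 hS).1).1)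
  have hcap0 : 0 ≤ cap2 M 5 G S := cap2_nonneg (capS_nonneg' hG hd.le S)
  obtain ⟨a, hadef⟩ : ∃ a, (coloops M S).card = a := ⟨_, rfl⟩
  have hcases : a = 4 ∨ a = 5 ∨ a = 6 := by omega
  rcases hcases with rfl | rfl | rfl
  · exact load2_le_cap2_of_four_five hs hl hG hd hk hS hadef
  · have hex := ex2_eq_empty_of_card_coloops_eq hs hG hS hadef
    have hload := load2_le_dq hG hd (by omega) S
    rw [hex, Finset.card_empty, Nat.cast_zero, zero_mul] at hload
    exact hload.trans hcap0
  · have hex := two_mul_card_ex2_le hG hS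
    rw [hadef] at hex
    have hex0 : (ex2 M 5 G S).card = 0 := by omega
    have hload := load2_le_dq hG hd (by omega) S
    rw [hex0, Nat.cast_zero, zero_mul] at hload
    exact hload.trans hcap0

/-- **The regime `|E ∖ G| = 5` at `q = 5` for every loopless simple matroid**: Theorem E (`k ≤ 3`),
`localShadowHall_of_kColoops` (`k ≥ 5`) and the cell `k = 4` above. -/
theorem localShadowHall_dq_five_of_simple (hs : ∀ e ∈ gr M, ∀ f ∈ gr M, e ≠ f → rkN M {e, f} = 2)
    (hl : ∀ e ∈ gr M, M.Indep {e}) (hG : G ∈ flatsQ M (5 + 1)) (hd : (gr M \ G).card = 5) :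
    LocalShadowHall M 5 G := by
  obtain ⟨k, hk⟩ : ∃ k, kColoops M G = k := ⟨_, rfl⟩
  by_cases h5 : 5 ≤ k
  · exact localShadowHall_of_kColoops hG hd.le (hk ▸ h5)
  · by_cases h4 : k = 4
    · exact localShadowHall_dq_five_four hs hl hG hd (hk.trans h4)
    · apply localShadowHall_dq hG hd
      rw [hk]
      have : k ≤ 3 := by omega
      interval_cases k <;> norm_num

end Five

end PercRepro.Shadow
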